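import Summits.BirchSwinnertonDyer.BirchSwinnertonDyer.Theorems.KolyvaginRoadThreeSchneiderTamAtThreeHeightLogNumeratorSecondOrderCore
import Summits.BirchSwinnertonDyer.BirchSwinnertonDyer.Theorems.KolyvaginRoadThreeSchneiderTamAtThreeHeightLogNumerator
import HarnessLib

/-!
# Crux `SchneiderTamAtThree` (item 19154) — THE HEIGHT IS THE LOGARITHM OF THE NUMERATOR, SECOND ORDER,
# part 2b/3: the main theorem `x(P)·Σ²_E(P) ≡ 1 − (b₂b₄/c₄)·x(P)⁻¹ (mod 3^{2k+1})`

HONEST FRAMING (cell `bsd-stepL`, seat `bsd-stepL-tam3-p2` g2, WIDTH-LEVER second lane «closed-form Schneider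
local factor at 3 … finite case table proved once»; `--supports stmt-BirchSwinnertonDyer-19154 --as helper`):
THEOREMS ONLY, unconditional, route-independent (no Theses import); 0 definitions, 0 named facts, 0 sorry;
nothing here proves the crux `SchneiderTamAtThree`, Schneider's conjecture or BSD.

* `norm_x_mul_tateSigmaValueSq_sub_one_add_le` — for `W/ℚ` globally minimal with multiplicative reduction
  at `3`, ANY `q ∈ ℚ₃` with `‖q‖₃ < 1` and any rational point `P = (x,y)` with `‖x‖₃ > 1`:
  **`‖x·Σ²_E(P) − 1 + (b₂b₄/c₄)·x⁻¹‖₃ ≤ 3⁻¹·‖x‖₃⁻¹`**, i.e. `x·Σ² ≡ 1 − (b₂b₄/c₄)/x (mod 3^{2k+1})`,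
  `3^{2k} ‖ den x(P)`, one `3`-adic digit deeper than part 3 of the first-order chain
  (`norm_x_mul_tateSigmaValueSq_sub_one_le`: `‖x·Σ² − 1‖ ≤ ‖x‖⁻¹`). The new digit is the FINITE CASE TABLE
  `κ ≡ −b₂b₄/c₄ (mod 3)` of the `z²`-coefficient of `x·Σ²` (part 1, `norm_kappa_add_le`). Consequences
  (part 3, `…SecondOrderCriterion.lean`): `ĥ₃(P) ≡ log₃ num x + (b₂b₄/c₄)·den x/num x (mod 3^{2k+1})` and
  the second-order numerator criterion `3^{v₃(den x)+1} ∤ c₄·(a³ − a) + 2b₂b₄·den x ⟹ ĥ₃(P) ≠ 0`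
  (`a = num x`), deciding 650 of the 690 tabulated TRUE-OPEN rows of lane A (first order: 543).

Proof (parts 2a + 2b; `z = −x/y`, `r = ‖z‖ = 3^{−k}`, `ℓ = log_W z = z(1+σ)`, `x z² = 1 + π`, `C2 = C²`, `L = ℓ²/C2`,
`λ = z²/(12C2)`, `μ = z⁴/(360C2²)`, `Σ² = C2·2(ch L − 1)·Π`): (a) `Π = 1 + O(r²/3)` (`‖q‖ ≤ 3⁻¹`);
(b) `2(ch L − 1) = L + L²/12 + L³/360 + O(9r⁸)` (part 1); (c) hence `x·Σ² ≡ M₃ :=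
(1+π)(1+σ)²·(1 + λ(1+σ)² + μ(1+σ)⁴)`; (d) `π = −a₁z − a₂z² + O(r³)` (equation to third order, part 1),
`σ = ½a₁z + ⅓(a₁²+a₂)z² + O(r³)` (formal logarithm to third order); (e) modulo terms of norm `≤ r²/3`,
`M₃ ≡ P(z) + λ(1 + a₁z + 4βz²) + μ` with `P = (1 − a₁z − a₂z²)(1 + ½a₁z + βz²)²`, `β = ⅓(a₁²+a₂)`, and the
EXACT polynomial identity `P + λ(1 + a₁z + 4βz²) + μ − 1 − κz² = A₃z³ + A₄z⁴ + P₅z⁵ + P₆z⁶`,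
`κ = (C⁻² − b₂)/12`, whose coefficients satisfy `‖A₃‖ ≤ 1` (by `C⁻² ≡ b₂`), `‖A₄‖ ≤ 3` (the mod-3
cancellation `9A₄ = (3β − C⁻²)² + 3(…) − (39/40)C⁻⁴`), `‖P₅‖, ‖P₆‖ ≤ 9`; (f) `κ ≡ −b₂b₄/c₄ (mod 3)` (part 1)
and `z² ≡ x⁻¹ (mod r³)`.

References: [SteinWuthrich2013] §4.1 (4.1), §4.2; [SilvermanAEC2009] IV.1, IV.5–6, VII.2; [MazurTate1991]
(the `σ`-function; here only through the tree's transcription); tree: parts 1–3 of the first-order chain.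
-/

noncomputable section

open scoped Classical Nat
open Filter Topology IsUltrametricDist PowerSeries
open WeierstrassCurve Literature.NumberTheory.EllipticCurves
open Literature.NumberTheory.EllipticCurves.SteinWuthrich2013
open Literature.NumberTheory.EllipticCurves.TateCurve
open Literature.NumberTheory.EllipticCurves.Rank1Residual
open Summit.BirchSwinnertonDyer.Uniform.UI.O2

namespace Summit.BirchSwinnertonDyer.Rank1Residual.X11b.RegMult.HeightLogNumerator

/-! ### §6 MAIN THEOREM, SECOND ORDER: `x(P)·Σ²_E(P) ≡ 1 − (b₂b₄/c₄)·x(P)⁻¹ (mod 3^{2k+1})` -/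

section Main

variable {W : WeierstrassCurve ℚ}

/-- **MAIN THEOREM, SECOND ORDER: `x(P)·Σ²_E(P) ≡ 1 − (b₂b₄/c₄)/x(P)` one digit beyond the depth of the
point.** For `W/ℚ` globally minimal with multiplicative reduction at `3`, ANY `q ∈ ℚ₃` with `‖q‖₃ < 1` and
any rational affine point `P = (x, y)` with `‖x‖₃ > 1`:
`‖x·Σ²_E(P) − 1 + (b₂b₄/c₄)·x⁻¹‖₃ ≤ 3⁻¹·‖x‖₃⁻¹` (`b₂, b₄, c₄` of the minimal model, read in `ℚ₃`;
`‖x‖⁻¹ = ‖z(P)‖² = ‖den x‖₃ = 3^{−2k}`). The first-order theorem (part 3 of the first chain) is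
`‖x·Σ² − 1‖ ≤ ‖x‖⁻¹`; the new `3`-adic digit is governed by the finite case table `κ ≡ −b₂b₄/c₄ (mod 3)`
for the `z²`-coefficient `κ = (C⁻² − b₂)/12` of `x·Σ²` — at `v₃(z) = 1` it also requires the `L³/360` term
of `ch`, the `z⁴`-level mod-3 cancellation of part 2a, and the equation and formal logarithm to third
order. Pre-registered on lane A's table of record (kit j249075): the resulting second-digit law holds in
147/147 first-order-silent rows (kit j281722).
[cite: SteinWuthrich2013, §4.2] [cite: SilvermanAEC2009, IV.1, IV.6.4, VII.2.2] -/
theorem norm_x_mul_tateSigmaValueSq_sub_one_add_le [W.IsElliptic] [W.IsGloballyMinimal] (hW : Mult W 3)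
    {q : ℚ_[3]} (hq : ‖q‖ < 1) {x y : ℚ} (hxy : W.toAffine.Nonsingular x y)
    (hx : 1 < ‖(x : ℚ_[3])‖) :
    ‖(x : ℚ_[3]) * tateSigmaValueSq W 3 q x y - 1 +
        (W.baseChange ℚ_[3]).b₂ * (W.baseChange ℚ_[3]).b₄ / (W.baseChange ℚ_[3]).c₄ * (x : ℚ_[3])⁻¹‖
      ≤ 3⁻¹ * ‖(x : ℚ_[3])‖⁻¹ := by
  -- the objects (as in part 3 of the first-order chain)
  set X : ℚ_[3] := (x : ℚ_[3]) with hXdef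
  set Y : ℚ_[3] := (y : ℚ_[3]) with hYdef
  set V : WeierstrassCurve ℚ_[3] := W.baseChange ℚ_[3] with hVdef
  set z : ℚ_[3] := -X / Y with hzdef
  set ℓ : ℚ_[3] := V.padicFormalLog z with hℓdef
  set C2 : ℚ_[3] := uniformisationScaleSq W 3 q with hC2def
  set L : ℚ_[3] := logUnitParamSq W 3 q x y with hLdef
  set c : ℚ_[3] := coshOfSq L with hcdef
  set Pr : ℚ_[3] := ∏' n : ℕ, (1 - 2 * q ^ (n + 1) * c + q ^ (2 * (n + 1))) ^ 2 /
    (1 - q ^ (n + 1)) ^ 4 with hPrdef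
  set κ' : ℚ_[3] := V.b₂ * V.b₄ / V.c₄ with hκ'def
  have hSig : tateSigmaValueSq W 3 q x y = C2 * (2 * (c - 1) * Pr) := rfl
  have hL : L = ℓ ^ 2 / C2 := rfl
  -- basic norms
  obtain ⟨hz, hz2⟩ := norm_neg_div_of_one_lt_norm (p := 3) hxy hx
  have hz3 : ‖z‖ ≤ 1 / 3 := hz.trans (by norm_num)
  have h3z1 : 3 * ‖z‖ ≤ 1 := by linarith
  have hX0 : 0 < ‖X‖ := one_pos.trans hx
  have hX0' : X ≠ 0 := norm_pos_iff.mp hX0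
  have hXz : ‖X‖ * ‖z‖ ^ 2 = 1 := by rw [hz2, mul_inv_cancel₀ hX0.ne']
  have hXinv : ‖X‖⁻¹ = ‖z‖ ^ 2 := hz2.symm
  have hzz : 0 < ‖z‖ := by
    have h : 0 < ‖z‖ ^ 2 := by rw [hz2]; exact inv_pos.mpr hX0
    rcases (norm_nonneg z).eq_or_lt with h0 | h0
    · rw [← h0] at h; norm_num at h
    · exact h0
  have hz0 : z ≠ 0 := norm_pos_iff.mp hzz
  obtain ⟨hz1, hz2le1, hz29, -, -, hr3, -, -, hr6⟩ := second_order_numerics ‖z‖ hzz hz3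
  obtain ⟨-, -, hr2d3, -⟩ := second_order_numerics' ‖z‖ hzz hz3
  obtain ⟨h2n, -, -, -, -, h12i, -, -, -, -⟩ := padic_three_constants
  obtain ⟨ha1, ha2, -, -, -⟩ := V.norm_coeffs_le_one
  have hC : ‖C2‖ = 1 := norm_uniformisationScaleSq_eq_one hW hq
  have hC0 : C2 ≠ 0 := norm_pos_iff.mp (by rw [hC]; exact one_pos)
  have hCi : ‖C2⁻¹‖ = 1 := by rw [norm_inv, hC, inv_one]
  -- the scale facts of part 1 (`C⁻² ≡ b₂`, `κ ≡ −b₂b₄/c₄ mod 3`, `‖b₂b₄/c₄‖ ≤ 1`)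
  have hb2 : V.b₂ = V.a₁ ^ 2 + 4 * V.a₂ := rfl
  have hCb : ‖C2⁻¹ - (V.a₁ ^ 2 + 4 * V.a₂)‖ ≤ 1 / 3 := by
    rw [← hb2]; exact norm_inv_scaleSq_sub_b₂_le hW hq
  have hκ' : ‖κ'‖ ≤ 1 := norm_b₂_mul_b₄_div_c₄_le hW
  have hκsum : ‖(C2⁻¹ - (V.a₁ ^ 2 + 4 * V.a₂)) / 12 + κ'‖ ≤ 1 / 3 := by
    rw [hκ'def, ← hb2]; exact norm_kappa_add_le hW hq
  have heq : V.toAffine.Equation X Y := (nonsingular_ratCast (p := 3) hxy).left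
  obtain ⟨hsq, hxyn⟩ := V.norm_sq_eq_norm_cube heq hx
  have hY0n : 0 < ‖Y‖ := hX0.trans hxyn
  have hY0 : Y ≠ 0 := norm_pos_iff.mp hY0n
  have hq3 : ‖q‖ ≤ 1 / 3 := by
    have := norm_le_inv_of_norm_lt_one hq
    simpa using this
  -- `‖z‖³ = ‖Y‖⁻¹`
  have hz3Y : ‖z‖ ^ 3 = ‖Y‖⁻¹ := by
    rw [hzdef, norm_div, norm_neg, div_pow, ← hsq]
    field_simp
  -- Step A: the equation to third order, `π := X z² − 1 = −a₁z − a₂z² + ρ₃`, `‖ρ₃‖ ≤ r³`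
  set ρ₃ : ℚ_[3] := X * z ^ 2 - 1 + V.a₁ * z + V.a₂ * z ^ 2 with hρ₃def
  have hρ₃ : ‖ρ₃‖ ≤ ‖z‖ ^ 3 := by
    have e : ρ₃ = X ^ 3 / Y ^ 2 - 1 - V.a₁ * (X / Y) + V.a₂ * (X / Y) ^ 2 := by
      rw [hρ₃def, hzdef]; field_simp; ring
    rw [e, hz3Y]
    exact norm_pow_three_div_sq_sub_cubic_le heq hx
  set π : ℚ_[3] := X * z ^ 2 - 1 with hπdef
  have hπ_eq : π = -(V.a₁ * z) - V.a₂ * z ^ 2 + ρ₃ := by rw [hπdef, hρ₃def]; ring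
  have hXz1 : ‖X * z ^ 2 - 1‖ ≤ ‖z‖ := by
    rw [← hπdef, hπ_eq]
    refine (norm_add_le_max _ _).trans (max_le ((norm_sub_le_max₃ _ _).trans (max_le ?_ ?_))
      (hρ₃.trans ?_))
    · rw [norm_neg, norm_mul]
      calc ‖V.a₁‖ * ‖z‖ ≤ 1 * ‖z‖ := by gcongr
        _ = ‖z‖ := one_mul _
    · rw [norm_mul, norm_pow]
      calc ‖V.a₂‖ * ‖z‖ ^ 2 ≤ 1 * ‖z‖ ^ 2 := by gcongr
        _ = ‖z‖ * ‖z‖ := by ring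
        _ ≤ 1 * ‖z‖ := by gcongr
        _ = ‖z‖ := one_mul _
    · calc ‖z‖ ^ 3 = ‖z‖ ^ 2 * ‖z‖ := by ring
        _ ≤ 1 * ‖z‖ := by gcongr
        _ = ‖z‖ := one_mul _
  have hπn : ‖π‖ ≤ ‖z‖ := by rw [hπdef]; exact hXz1
  -- Step B: the formal logarithm to third order, `ℓ = z(1 + σ)`, `σ = ½a₁z + ⅓(a₁²+a₂)z² + τ/z`
  set τ : ℚ_[3] := ℓ - (z + (2 : ℚ_[3])⁻¹ * V.a₁ * z ^ 2 + (3 : ℚ_[3])⁻¹ * (V.a₁ ^ 2 + V.a₂) * z ^ 3)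
    with hτdef
  have hτ : ‖τ‖ ≤ ‖z‖ ^ 4 := norm_padicFormalLog_sub_cubic_le_pow_four V hz3
  set σ : ℚ_[3] := (ℓ - z) / z with hσdef
  have hℓσ : ℓ = z * (1 + σ) := by rw [hσdef]; field_simp; ring
  have hσ_eq : σ = (2 : ℚ_[3])⁻¹ * V.a₁ * z + (3 : ℚ_[3])⁻¹ * (V.a₁ ^ 2 + V.a₂) * z ^ 2 + τ / z := by
    rw [hσdef, hτdef]; field_simp; ring
  have hw : ‖ℓ - z‖ ≤ ‖z‖ ^ 2 := by
    have e : ℓ - z = (2 : ℚ_[3])⁻¹ * V.a₁ * z ^ 2 + (3 : ℚ_[3])⁻¹ * (V.a₁ ^ 2 + V.a₂) * z ^ 3 + τ := by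
      rw [hτdef]; ring
    rw [e]
    have h2i : ‖(2 : ℚ_[3])⁻¹‖ = 1 := by rw [norm_inv, h2n, inv_one]
    have h3i : ‖(3 : ℚ_[3])⁻¹‖ = 3 := by
      rw [norm_inv, show (3 : ℚ_[3]) = ((3 : ℕ) : ℚ_[3]) by norm_cast, Padic.norm_p]; norm_num
    have ha12 : ‖V.a₁ ^ 2 + V.a₂‖ ≤ 1 :=
      (norm_add_le_max _ _).trans (max_le (by rw [norm_pow]; exact pow_le_one₀ (norm_nonneg _) ha1) ha2)
    refine (norm_add_le_max _ _).trans (max_le ((norm_add_le_max _ _).trans (max_le ?_ ?_)) ?_)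
    · rw [norm_mul, norm_mul, h2i, one_mul, norm_pow]
      calc ‖V.a₁‖ * ‖z‖ ^ 2 ≤ 1 * ‖z‖ ^ 2 := by gcongr
        _ = ‖z‖ ^ 2 := one_mul _
    · rw [norm_mul, norm_mul, h3i, norm_pow]
      calc 3 * ‖V.a₁ ^ 2 + V.a₂‖ * ‖z‖ ^ 3 ≤ 3 * 1 * ‖z‖ ^ 3 := by gcongr
        _ = (3 * ‖z‖) * ‖z‖ ^ 2 := by ring
        _ ≤ 1 * ‖z‖ ^ 2 := by gcongr
        _ = ‖z‖ ^ 2 := one_mul _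
    · calc ‖τ‖ ≤ ‖z‖ ^ 4 := hτ
        _ = ‖z‖ ^ 2 * ‖z‖ ^ 2 := by ring
        _ ≤ 1 * ‖z‖ ^ 2 := by gcongr
        _ = ‖z‖ ^ 2 := one_mul _
  have hσ : ‖σ‖ ≤ ‖z‖ := by
    rw [hσdef, norm_div, div_le_iff₀ hzz]
    calc ‖ℓ - z‖ ≤ ‖z‖ ^ 2 := hw
      _ = ‖z‖ * ‖z‖ := by ring
  have hℓn : ‖ℓ‖ = ‖z‖ := by
    rw [hℓσ, norm_mul]
    have h1σ : ‖1 + σ‖ = 1 := by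
      rw [norm_add_eq_max_of_norm_ne_norm (by rw [norm_one]; exact (lt_of_le_of_lt hσ (hz3.trans_lt
        (by norm_num))).ne'), norm_one, max_eq_left (hσ.trans hz1)]
    rw [h1σ, mul_one]
  have hLn : ‖L‖ = ‖z‖ ^ 2 := by rw [hL, norm_div, norm_pow, hℓn, hC, div_one]
  have hL9 : ‖L‖ ≤ 1 / 9 := by rw [hLn]; exact hz29
  -- Step C: `cosh` to third order and the product
  set D₃ : ℚ_[3] := 2 * (c - 1) - L - L ^ 2 / 12 - L ^ 3 / 360 with hD₃def
  have hD₃ : ‖D₃‖ ≤ 9 * ‖L‖ ^ 4 := norm_two_mul_coshOfSq_sub_cubic_le hL9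
  have hc1 : ‖c - 1‖ ≤ ‖L‖ := by
    have hL' : ‖L‖ ≤ ((3 : ℝ)⁻¹) ^ 2 := hL9.trans (by norm_num)
    obtain ⟨R, hR, hRle⟩ := coshOfSq_eq_one_add_half_add (p := 3) (by norm_num) hL'
    rw [hcdef, hR, show 1 + L / 2 + R - 1 = L / 2 + R by ring]
    refine (norm_add_le_max _ _).trans (max_le ?_ (hRle.trans ?_))
    · rw [div_eq_mul_inv, norm_mul, norm_inv, h2n, inv_one, mul_one]
    · calc ‖L‖ * ((3 : ℕ) : ℝ)⁻¹ ≤ ‖L‖ * 1 := by gcongr; norm_num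
        _ = ‖L‖ := mul_one _
  have hcn : ‖c‖ ≤ 1 := by
    have hL' : ‖L‖ ≤ ((3 : ℝ)⁻¹) ^ 2 := hL9.trans (by norm_num)
    exact (norm_coshOfSq_eq_one (p := 3) (by norm_num) hL').le
  have hPr : ‖Pr - 1‖ ≤ ‖z‖ ^ 2 / 3 := by
    refine (norm_tprod_tateSigmaSq_factor_sub_one_le_mul hq hcn).trans ?_
    calc ‖q‖ * ‖c - 1‖ ≤ (1 / 3) * ‖L‖ := by gcongr
      _ = ‖z‖ ^ 2 / 3 := by rw [hLn]; ring
  -- freeze the analytic objects: from here on only the recorded equations and bounds are used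
  clear_value Pr c L ℓ C2 τ σ z X Y
  -- Step D: `M₃ = X·C2·(L + L²/12 + L³/360)` is the analytic core expression of part 2a
  set M₃ : ℚ_[3] := X * C2 * (L + L ^ 2 / 12 + L ^ 3 / 360) with hM₃def
  have hM₃_eq : M₃ = (1 + π) * (1 + σ) ^ 2 * (1 + (12 : ℚ_[3])⁻¹ * C2⁻¹ * z ^ 2 * (1 + σ) ^ 2 +
      (360 : ℚ_[3])⁻¹ * C2⁻¹ ^ 2 * z ^ 4 * (1 + σ) ^ 4) := by
    rw [hM₃def, hL, hℓσ, hπdef]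
    field_simp
    ring
  set κC : ℚ_[3] := (C2⁻¹ - (V.a₁ ^ 2 + 4 * V.a₂)) / 12 with hκCdef
  have hM₃κ : ‖M₃ - 1 - κC * z ^ 2‖ ≤ ‖z‖ ^ 2 / 3 := by
    rw [hM₃_eq, hκCdef]
    exact second_order_core_bound ha1 ha2 hCi hCb hz0 hzz hz3 hπ_eq hρ₃ hσ_eq hτ
  have hκC : ‖κC‖ ≤ 1 := by
    rw [hκCdef, div_eq_mul_inv, norm_mul, h12i]
    calc ‖C2⁻¹ - (V.a₁ ^ 2 + 4 * V.a₂)‖ * 3 ≤ (1 / 3) * 3 := by gcongr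
      _ = 1 := by norm_num
  have hM₃n : ‖M₃‖ ≤ 1 := by
    rw [show M₃ = (M₃ - 1 - κC * z ^ 2) + κC * z ^ 2 + 1 by ring]
    refine (norm_add_le_max _ _).trans (max_le ((norm_add_le_max _ _).trans (max_le
      (hM₃κ.trans hr2d3) ?_)) (by simp))
    rw [norm_mul, norm_pow]
    calc ‖κC‖ * ‖z‖ ^ 2 ≤ 1 * 1 := by gcongr
      _ = 1 := one_mul _
  -- Step E: `x·Σ² − 1 + κ'/X = M(Pr − 1) + ((M₃ − 1 − κC z²) + X·C2·D₃) + ((κC + κ')z² − κ'·X⁻¹·π)`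
  set M : ℚ_[3] := X * C2 * (2 * (c - 1)) with hMdef
  have hMM₃ : M = M₃ + X * C2 * D₃ := by rw [hMdef, hM₃def, hD₃def]; ring
  have hXD : ‖X * C2 * D₃‖ ≤ ‖z‖ ^ 2 / 3 := by
    rw [norm_mul, norm_mul, hC, mul_one]
    calc ‖X‖ * ‖D₃‖ ≤ ‖X‖ * (9 * ‖L‖ ^ 4) := by gcongr
      _ = 9 * (‖X‖ * ‖z‖ ^ 2) * ‖z‖ ^ 6 := by rw [hLn]; ring
      _ = 9 * ‖z‖ ^ 6 := by rw [hXz]; ring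
      _ ≤ ‖z‖ ^ 2 / 3 := hr6
  have hMn : ‖M‖ ≤ 1 := by
    rw [hMM₃]
    exact (norm_add_le_max _ _).trans (max_le hM₃n (hXD.trans hr2d3))
  have hfin : X * tateSigmaValueSq W 3 q x y - 1 + κ' * X⁻¹ =
      M * (Pr - 1) + ((M₃ - 1 - κC * z ^ 2) + X * C2 * D₃) + ((κC + κ') * z ^ 2 - κ' * (X⁻¹ * π)) := by
    rw [hSig, hMM₃, hM₃def, hD₃def, hπdef]
    field_simp
    ring
  have hκsum' : ‖κC + κ'‖ ≤ 1 / 3 := by rw [hκCdef]; exact hκsum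
  rw [hfin, hXinv, show (3 : ℝ)⁻¹ * ‖z‖ ^ 2 = ‖z‖ ^ 2 / 3 by ring]
  refine (norm_add_le_max _ _).trans (max_le ((norm_add_le_max _ _).trans (max_le ?_
    ((norm_add_le_max _ _).trans (max_le hM₃κ hXD)))) ?_)
  · rw [norm_mul]
    calc ‖M‖ * ‖Pr - 1‖ ≤ 1 * (‖z‖ ^ 2 / 3) := by gcongr
      _ = ‖z‖ ^ 2 / 3 := one_mul _
  · refine (norm_sub_le_max₃ _ _).trans (max_le ?_ ?_)
    · rw [norm_mul, norm_pow]
      calc ‖κC + κ'‖ * ‖z‖ ^ 2 ≤ (1 / 3) * ‖z‖ ^ 2 := by gcongr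
        _ = ‖z‖ ^ 2 / 3 := by ring
    · rw [norm_mul, norm_mul, norm_inv, hXinv]
      calc ‖κ'‖ * (‖z‖ ^ 2 * ‖π‖) ≤ 1 * (‖z‖ ^ 2 * ‖z‖) := by gcongr
        _ = ‖z‖ ^ 3 := by ring
        _ ≤ ‖z‖ ^ 2 / 3 := hr3

end Main

end Summit.BirchSwinnertonDyer.Rank1Residual.X11b.RegMult.HeightLogNumerator

end
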